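import Summits.CriticalPhenomena.PercolationContinuityZ3.Theorems.PercNearOneGluingNoHeavyLowerTailQ44bCrossPendantExchange
import HarnessLib

/-!
# Given no cross connection, `a ~ b` and `c ~ y` are negatively correlated: `P(ab|cy)·P(a|b|c|y) ≤ P(ab|c|y)·P(a|b|cy)`

Support file for crux `stmt-CriticalPhenomena-4575` (`NoHeavyLowerTail`; the quadratic four-point row `Q44b`,
OPEN for all `n`), seat `prim-l12-p1` gen 7; memo `run/shared/lean/prim/prim-l12/FROM-prim-l12-p1-g7-REIMER-CERTIFICATES.md` §9.

Bond percolation `μ = prodBernoulli w` with arbitrary edge weights on a finite vertex type, four vertices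
`a b c y`; `P(π)` = probability that the open clusters induce the partition `π` of `{a,b,c,y}`.  This file proves,
for EVERY finite weighted graph,

* `twoLink_negCorr`: with `D = {a≁c} ∩ {a≁y} ∩ {b≁c} ∩ {b≁y}` (no open path between `{a,b}` and `{c,y}`),
  `μ(D ∩ {a~b} ∩ {c~y}) · μ(D) ≤ μ(D ∩ {a~b}) · μ(D ∩ {c~y})` — van den Berg–Häggström–Kahn's Theorem 1.4
  WITH VERTEX SETS `S = {a,b}`, `T = {c,y}` (tree: `setClusterEventExchange`), for the increasing cluster
  functions `[C_S connects a,b]`, `[C_T connects c,y]`;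
* `twoLink_cells`: the same inequality in cells, **`P(ab|cy) · P(a|b|c|y) ≤ P(ab|c|y) · P(a|b|cy)`**
  (expand `μ(D) = P(ab|cy)+P(ab|c|y)+P(a|b|cy)+P(∅)` and cancel).

Role (memo §9): the census lane ttrl3 observed on 2.03·10⁹ exact instances that `R5 := Q44b − Q44b-top =
P(ab|cy)P(∅) − P(ab|c|y)P(a|b|cy)` is never positive; `twoLink_cells` is that fact as a theorem, so at law level
the row 'Q44b-top' (`P(abcy)P(∅) ≥ T1 + P(ab|c|y)[P(acy|b)+P(a|bcy)] + T3`, the law shadow of the fibre conjecture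
P1) is implied by `Q44b`.  Theorems only (no definitions, no named facts); standard axioms.
-/

namespace Summit.CriticalPhenomena.PercolationContinuityZ3.Theorems

namespace Q44bExchange

open MeasureTheory Set
open Literature.Probability.LatticeModels (prodBernoulli)
open Literature.Probability.Percolation

variable {V : Type*} [Fintype V]

/-- **Negative correlation of the two links across a separation** (BHK 2006, Thm. 1.4 with the vertex sets
`{a,b}`, `{c,y}`): `μ(D ∩ ab ∩ cy) · μ(D) ≤ μ(D ∩ ab) · μ(D ∩ cy)` with
`D = {a≁c} ∩ {a≁y} ∩ {b≁c} ∩ {b≁y}`. [cite: VandenbergHaggstromKahn2005, Thm. 1.4 (p. 7) with Remark 1 (p. 5) — corollary] -/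
theorem twoLink_negCorr (w : Sym2 V → unitInterval) (a b c y : V) :
    (prodBernoulli w).real ((openConn a c)ᶜ ∩ (openConn a y)ᶜ ∩ (openConn b c)ᶜ ∩ (openConn b y)ᶜ ∩
          (openConn a b ∩ openConn c y)) *
        (prodBernoulli w).real ((openConn a c)ᶜ ∩ (openConn a y)ᶜ ∩ (openConn b c)ᶜ ∩ (openConn b y)ᶜ) ≤
      (prodBernoulli w).real ((openConn a c)ᶜ ∩ (openConn a y)ᶜ ∩ (openConn b c)ᶜ ∩ (openConn b y)ᶜ ∩
          openConn a b) *
        (prodBernoulli w).real ((openConn a c)ᶜ ∩ (openConn a y)ᶜ ∩ (openConn b c)ᶜ ∩ (openConn b y)ᶜ ∩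
          openConn c y) := by
  classical
  have ha : a ∈ ({a, b} : Set V) := by simp
  have hc : c ∈ ({c, y} : Set V) := by simp
  have key := setClusterEventExchange w ({a, b} : Set V) ({c, y} : Set V)
    (fun C => (SimpleGraph.fromEdgeSet C).Reachable a b) (fun _ => True)
    (fun C => (SimpleGraph.fromEdgeSet C).Reachable c y) (fun _ => True)
    (PathExchange.reachIn_mono a b) (fun _ _ _ h => h)
    (PathExchange.reachIn_mono c y) (fun _ _ _ h => h)
  have hD : {ω : BondConfig V | ∀ s ∈ ({a, b} : Set V), ∀ t ∈ ({c, y} : Set V),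
      ¬ (openGraph ω).Reachable s t} =
      (openConn a c)ᶜ ∩ (openConn a y)ᶜ ∩ (openConn b c)ᶜ ∩ (openConn b y)ᶜ := by
    ext ω
    simp only [mem_setOf_eq, mem_insert_iff, mem_singleton_iff, forall_eq_or_imp, forall_eq,
      mem_inter_iff, mem_compl_iff, openConn]
    tauto
  simp only [setOf_fromEdgeSet_biUnion_reachable _ ha, setOf_fromEdgeSet_biUnion_reachable _ hc,
    setOf_true, inter_univ, hD] at key
  exact key

/-- **`P(ab|cy) · P(a|b|c|y) ≤ P(ab|c|y) · P(a|b|cy)`** on every finite weighted graph (cells as intersections of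
the six connection events and their complements, in the order `ab, ac, ay, bc, by, cy`).  From `twoLink_negCorr` by
`μ(D) = P(ab|cy) + P(ab|c|y) + P(a|b|cy) + P(a|b|c|y)`, `μ(D ∩ ab) = P(ab|cy) + P(ab|c|y)`,
`μ(D ∩ cy) = P(ab|cy) + P(a|b|cy)`. [this work] -/
theorem twoLink_cells (w : Sym2 V → unitInterval) (a b c y : V) :
    (prodBernoulli w).real (openConn a b ∩ (openConn a c)ᶜ ∩ (openConn a y)ᶜ ∩ (openConn b c)ᶜ ∩
          (openConn b y)ᶜ ∩ openConn c y) *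
        (prodBernoulli w).real ((openConn a b)ᶜ ∩ (openConn a c)ᶜ ∩ (openConn a y)ᶜ ∩ (openConn b c)ᶜ ∩
          (openConn b y)ᶜ ∩ (openConn c y)ᶜ) ≤
      (prodBernoulli w).real (openConn a b ∩ (openConn a c)ᶜ ∩ (openConn a y)ᶜ ∩ (openConn b c)ᶜ ∩
          (openConn b y)ᶜ ∩ (openConn c y)ᶜ) *
        (prodBernoulli w).real ((openConn a b)ᶜ ∩ (openConn a c)ᶜ ∩ (openConn a y)ᶜ ∩ (openConn b c)ᶜ ∩
          (openConn b y)ᶜ ∩ openConn c y) := by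
  classical
  set μ := prodBernoulli w with hμ
  set D : Set (BondConfig V) :=
    (openConn a c)ᶜ ∩ (openConn a y)ᶜ ∩ (openConn b c)ᶜ ∩ (openConn b y)ᶜ with hD
  set Ab : Set (BondConfig V) := openConn a b with hAb
  set Cy : Set (BondConfig V) := openConn c y with hCy
  have hN := twoLink_negCorr w a b c y
  simp only [← hμ, ← hD, ← hAb, ← hCy] at hN
  -- measurability is automatic on the finite configuration space
  have hmeas : ∀ s : Set (BondConfig V), MeasurableSet s := fun _ => MeasurableSet.of_discrete
  -- the four cells of D
  set m11 := μ.real (D ∩ (Ab ∩ Cy)) with hm11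
  set mA := μ.real (D ∩ Ab) with hmA
  set mC := μ.real (D ∩ Cy) with hmC
  set δ := μ.real D with hδ
  -- cells rewritten as pieces of D
  have c11 : μ.real (Ab ∩ (openConn a c)ᶜ ∩ (openConn a y)ᶜ ∩ (openConn b c)ᶜ ∩ (openConn b y)ᶜ ∩ Cy) = m11 := by
    have hset : Ab ∩ (openConn a c)ᶜ ∩ (openConn a y)ᶜ ∩ (openConn b c)ᶜ ∩ (openConn b y)ᶜ ∩ Cy = D ∩ (Ab ∩ Cy) := by
      ext ω; simp only [hD, mem_inter_iff, mem_compl_iff]; tauto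
    rw [hset]
  have c10 : μ.real (Ab ∩ (openConn a c)ᶜ ∩ (openConn a y)ᶜ ∩ (openConn b c)ᶜ ∩ (openConn b y)ᶜ ∩ Cyᶜ) = mA - m11 := by
    have h := measureReal_inter_add_sdiff (μ := μ) (s := D ∩ Ab) (hmeas Cy)
    have hset1 : D ∩ Ab ∩ Cy = D ∩ (Ab ∩ Cy) := by
      ext ω; simp only [mem_inter_iff]; tauto
    have hset2 : (D ∩ Ab) \ Cy = Ab ∩ (openConn a c)ᶜ ∩ (openConn a y)ᶜ ∩ (openConn b c)ᶜ ∩ (openConn b y)ᶜ ∩ Cyᶜ := by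
      ext ω; simp only [hD, mem_sdiff, mem_inter_iff, mem_compl_iff]; tauto
    rw [hset1, hset2] at h
    linarith
  have c01 : μ.real (Abᶜ ∩ (openConn a c)ᶜ ∩ (openConn a y)ᶜ ∩ (openConn b c)ᶜ ∩ (openConn b y)ᶜ ∩ Cy) = mC - m11 := by
    have h := measureReal_inter_add_sdiff (μ := μ) (s := D ∩ Cy) (hmeas Ab)
    have hset1 : D ∩ Cy ∩ Ab = D ∩ (Ab ∩ Cy) := by
      ext ω; simp only [mem_inter_iff]; tauto
    have hset2 : (D ∩ Cy) \ Ab = Abᶜ ∩ (openConn a c)ᶜ ∩ (openConn a y)ᶜ ∩ (openConn b c)ᶜ ∩ (openConn b y)ᶜ ∩ Cy := by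
      ext ω; simp only [hD, mem_sdiff, mem_inter_iff, mem_compl_iff]; tauto
    rw [hset1, hset2] at h
    linarith
  have c00 : μ.real (Abᶜ ∩ (openConn a c)ᶜ ∩ (openConn a y)ᶜ ∩ (openConn b c)ᶜ ∩ (openConn b y)ᶜ ∩ Cyᶜ) =
      δ - mA - mC + m11 := by
    -- δ = μ(D ∩ Ab) + μ(D \ Ab);  μ(D \ Ab) = μ((D \ Ab) ∩ Cy) + μ((D \ Ab) \ Cy)
    have h1 := measureReal_inter_add_sdiff (μ := μ) (s := D) (hmeas Ab)
    have h2 := measureReal_inter_add_sdiff (μ := μ) (s := D \ Ab) (hmeas Cy)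
    have hset1 : (D \ Ab) ∩ Cy = Abᶜ ∩ (openConn a c)ᶜ ∩ (openConn a y)ᶜ ∩ (openConn b c)ᶜ ∩ (openConn b y)ᶜ ∩ Cy := by
      ext ω; simp only [hD, mem_sdiff, mem_inter_iff, mem_compl_iff]; tauto
    have hset2 : (D \ Ab) \ Cy = Abᶜ ∩ (openConn a c)ᶜ ∩ (openConn a y)ᶜ ∩ (openConn b c)ᶜ ∩ (openConn b y)ᶜ ∩ Cyᶜ := by
      ext ω; simp only [hD, mem_sdiff, mem_inter_iff, mem_compl_iff]; tauto
    rw [hset1, hset2, c01] at h2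
    linarith
  rw [c11, c10, c01, c00]
  nlinarith [hN]

end Q44bExchange

end Summit.CriticalPhenomena.PercolationContinuityZ3.Theorems
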